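import Summits.QuantumFields.YangMills.Theorems.SwapVirialDeficitBlowUpGnomonicFibreDefs
import HarnessLib

/-!
# Route `SwapVirialDeficit` (YangMills): THE EUCLIDEAN FIBRE OF THE STRATUM-B TUBES — base `u ∈ ℝ²` (the transverse `x`-letter), fibre `(δ, x₀, y₀ | y_⊥ | z | η_F)`
# with the hub letter `δ = cot ψ` IN THE FIBRE (definitions + API; cell ym-idea-1, LEAD g98 ➎ (S-B) 19:11:58Z ∕ 19:22Z ∕ 19:34Z, «w2 builds the δ-in-fibre fibred lemma once»)

After ✓`gnoDeficit_eq_hubCot` ∕ ✓`lintegral_chartMeasure_hubCot` (file ⧗`…ConeMeasureHubCot`) every ➎ region integral lives on `ℝ × GnoCoord L` (hub letter `δ`, gnomonic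
coordinates `η`) against `((1+δ²)⁻¹)² dδ ⊗ ρ(η)dη`.  The B-tube region `{|δ| small} × {|u| ≥ τ}` (✓`gnoDeficit_stratumB_eq_zero`: flat at `δ = x₀ = 0`, `y = z = η_F = 0`
over every `u`) is a fibred Laplace integral with BASE `u = (x₁, x₂) ∈ ℝ²` and FIBRE `(δ, x₀, y₀, y₁, y₂, z, η_F)` — dimension `8 + 3|Fol L| = 2α + 1` (LEAD: exponent
`α + ½`).  This file is the twin of ✓`…BlowUpGnomonicFibreDefs` for that split:
* §1 `GnoFibreBIdx L = (Fin 3 ⊕ Fin 2) ⊕ (Fin 3 ⊕ Fol L × Fin 3)` (blocks `t = (δ, x₀, y₀)`, `v = y_⊥`, `z`, `η_F`), `GnoFibreB L = EuclideanSpace ℝ (GnoFibreBIdx L)`,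
  `gnoBaseB u`, `gnoFibreBBlocks`, the linear chart `gnoFibreBLin ∕ gnoFibreBCLE ∕ gnoFibreBEquiv : (ℝ × ℝ) × GnoFibreB L ≃ ℝ × GnoCoord L`, `gnoFibreBEmb`;
* §2 API: `gnoFibreBEquiv_apply'`, `gnoFibreBEquiv_apply` (`= gnoBaseB u + gnoFibreBEmb y`), `norm_sq_gnoFibreB`, `card_gnoFibreBIdx`, `finrank_gnoFibreB_real`
  (`= 8 + 3|Fol L|`), `measurable_gnoFibreBEquiv`, cylinder ∕ tube lemmas;
* §3 `gnoFibreBBlocksEquiv` + volume preservation, ★★ `volume_preserving_gnoFibreBEquiv`, ★ `volume_withDensity_eq_map_gnoFibreBEquiv` (global chart identity).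

HONEST LABEL: definitions and measure-theoretic API only (reviewed Defs file of the route's posited objects); the B-tube law, its floors' packaging, all region stubs,
⟨24197⟩ ∕ ⟨24194⟩ OPEN; own crux ⟨22884⟩ `LargeFieldMassRefinementTail` OPEN (blocked-on ⟨19935⟩); the Yang–Mills mass gap is NOT proved; no summit is proved by a
line.  No instance, no notation, 0 `sorry`, standard axioms.  Width seat ym-line-sfw-p2-w2 g59 (cell ym-idea-1, free hands), `--supports stmt-QuantumFields-24197`.
References: [cite: Luscher1983, §2]; [cite: Breitung1994, §2.3 Definitions 4–5]; [folklore].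
-/

set_option autoImplicit false
set_option synthInstance.maxSize 1024

noncomputable section

open MeasureTheory Set
open scoped BigOperators ENNReal

namespace Summit.QuantumFields.YangMills.Theorems.SwapVirialDeficit.BlowUpRing

open Summit.QuantumFields.YangMills.Theorems.FemtoTransferGap
open Summit.QuantumFields.YangMills.Theorems.SwapVirialDeficit.Gnomonic (normSq3)

variable {L : ℕ} [NeZero L]

/-! ## §1 The B-fibre, its base point and the linear chart -/

variable (L) in
/-- INDEX SET OF THE B-FIBRE LETTERS: `(t : Fin 3) ⊕ (y_⊥ : Fin 2)` (`t = (δ, x₀, y₀)`), then `(z : Fin 3) ⊕ (followers : Fol L × Fin 3)`. [folklore] -/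
abbrev GnoFibreBIdx : Type := (Fin 3 ⊕ Fin 2) ⊕ (Fin 3 ⊕ Fol L × Fin 3)

variable (L) in
/-- THE EUCLIDEAN B-FIBRE `V_B`: `ℝ^{(Fin 3 ⊕ Fin 2) ⊕ (Fin 3 ⊕ Fol L × Fin 3)}` with its `ℓ²` inner product (`8 + 3|Fol L| = 2α + 1` dimensions). [folklore] -/
abbrev GnoFibreB : Type := EuclideanSpace ℝ (GnoFibreBIdx L)

/-- THE B-BASE POINT over `u = (u₁, u₂)`: hub letter `δ = 0`, `x = (0, u₁, u₂)`, `y = z = 0`, followers `0` (stratum B, ✓`gnoDeficit_stratumB_eq_zero`). [folklore] -/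
def gnoBaseB (u : ℝ × ℝ) : ℝ × GnoCoord L :=
  (0, (((![0, u.1, u.2] : Fin 3 → ℝ), (0 : Fin 3 → ℝ)), ((0 : Fin 3 → ℝ), (0 : Fol L → Fin 3 → ℝ))))

/-- THE FOUR LETTER BLOCKS `((t, v), z, η_F)` of a B-fibre vector, `t = (δ, x₀, y₀)`, `v = y_⊥`. [folklore] -/
def gnoFibreBBlocks (y : GnoFibreB L) : ((Fin 3 → ℝ) × (Fin 2 → ℝ)) × (Fin 3 → ℝ) × (Fol L → Fin 3 → ℝ) :=
  (((fun j => y (Sum.inl (Sum.inl j))), (fun j => y (Sum.inl (Sum.inr j)))), ((fun k => y (Sum.inr (Sum.inl k))), (fun f k => y (Sum.inr (Sum.inr (f, k))))))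

/-- The inverse reading: the B-fibre vector of a point of `ℝ × GnoCoord L` (drop `u`). [folklore] -/
def gnoFibreBOf (p : ℝ × GnoCoord L) : GnoFibreB L :=
  WithLp.toLp 2 (Sum.elim (Sum.elim (![p.1, p.2.1.1 0, p.2.1.2 0] : Fin 3 → ℝ) (fun j : Fin 2 => p.2.1.2 j.succ))
    (Sum.elim (fun k : Fin 3 => p.2.2.1 k) (fun fk : Fol L × Fin 3 => p.2.2.2 fk.1 fk.2)))

/-- THE LINEAR B-CHART `(u, y) ↦ (δ, ((x₀, u₁, u₂), (y₀, v₁, v₂)), z, η_F)` as a linear equivalence `(ℝ × ℝ) × V_B ≃ₗ ℝ × GnoCoord L`. [folklore] -/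
def gnoFibreBLin : ((ℝ × ℝ) × GnoFibreB L) ≃ₗ[ℝ] ℝ × GnoCoord L where
  toFun q := (q.2 (Sum.inl (Sum.inl 0)),
    ((((![q.2 (Sum.inl (Sum.inl 1)), q.1.1, q.1.2] : Fin 3 → ℝ), (![q.2 (Sum.inl (Sum.inl 2)), q.2 (Sum.inl (Sum.inr 0)), q.2 (Sum.inl (Sum.inr 1))] : Fin 3 → ℝ)),
      ((fun k => q.2 (Sum.inr (Sum.inl k))), (fun f k => q.2 (Sum.inr (Sum.inr (f, k)))))) : GnoCoord L))
  invFun p := ((p.2.1.1 1, p.2.1.1 2), gnoFibreBOf p)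
  map_add' q q' := by
    refine Prod.ext rfl (Prod.ext (Prod.ext ?_ ?_) (Prod.ext ?_ ?_))
    · funext k; fin_cases k <;> simp
    · funext k; fin_cases k <;> simp
    · funext k; simp
    · funext f k; simp
  map_smul' c q := by
    refine Prod.ext rfl (Prod.ext (Prod.ext ?_ ?_) (Prod.ext ?_ ?_))
    · funext k; fin_cases k <;> simp
    · funext k; fin_cases k <;> simp
    · funext k; simp
    · funext f k; simp
  left_inv q := by
    obtain ⟨⟨u₁, u₂⟩, y⟩ := q
    refine Prod.ext (Prod.ext rfl rfl) ?_
    refine PiLp.ext fun i => ?_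
    rcases i with ((j | j) | (k | ⟨f, k⟩))
    · fin_cases j <;> rfl
    · fin_cases j <;> rfl
    · rfl
    · rfl
  right_inv p := by
    obtain ⟨δ, ⟨x, y⟩, z, F⟩ := p
    refine Prod.ext rfl (Prod.ext (Prod.ext ?_ ?_) (Prod.ext ?_ ?_))
    · funext k; fin_cases k <;> rfl
    · funext k; fin_cases k <;> rfl
    · rfl
    · rfl

/-- The same chart as a CONTINUOUS linear equivalence (finite dimensions). [folklore] -/
def gnoFibreBCLE : ((ℝ × ℝ) × GnoFibreB L) ≃L[ℝ] ℝ × GnoCoord L :=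
  (gnoFibreBLin (L := L)).toContinuousLinearEquiv

/-- ★ THE B-FIBRE∕BASE SPLIT OF `ℝ × GnoCoord L` AS A MEASURABLE EQUIVALENCE `(ℝ × ℝ) × V_B ≃ᵐ ℝ × GnoCoord L`. [folklore] -/
def gnoFibreBEquiv : ((ℝ × ℝ) × GnoFibreB L) ≃ᵐ ℝ × GnoCoord L :=
  (gnoFibreBCLE (L := L)).toHomeomorph.toMeasurableEquiv

/-- THE B-FIBRE EMBEDDING `y ↦ (δ, ((x₀, 0, 0), (y₀, v)), z, η_F)` as a continuous linear map `V_B →L ℝ × GnoCoord L`. [folklore] -/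
def gnoFibreBEmb : GnoFibreB L →L[ℝ] ℝ × GnoCoord L :=
  (gnoFibreBCLE (L := L)).toContinuousLinearMap.comp (ContinuousLinearMap.inr ℝ (ℝ × ℝ) (GnoFibreB L))

/-! ## §2 API: formulas, the gauge identity, the dimension, cylinders -/

/-- The chart, pointwise. [folklore] -/
theorem gnoFibreBEquiv_apply' (q : (ℝ × ℝ) × GnoFibreB L) :
    gnoFibreBEquiv q = (q.2 (Sum.inl (Sum.inl 0)),
      ((((![q.2 (Sum.inl (Sum.inl 1)), q.1.1, q.1.2] : Fin 3 → ℝ), (![q.2 (Sum.inl (Sum.inl 2)), q.2 (Sum.inl (Sum.inr 0)), q.2 (Sum.inl (Sum.inr 1))] : Fin 3 → ℝ)),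
        ((fun k => q.2 (Sum.inr (Sum.inl k))), (fun f k => q.2 (Sum.inr (Sum.inr (f, k)))))) : GnoCoord L)) := rfl

/-- The measurable chart and the continuous linear chart are the same map. [folklore] -/
theorem gnoFibreBEquiv_apply_eq_CLE (q : (ℝ × ℝ) × GnoFibreB L) : gnoFibreBEquiv q = gnoFibreBCLE q := rfl

/-- The inverse chart, pointwise. [folklore] -/
theorem gnoFibreBEquiv_symm_apply (p : ℝ × GnoCoord L) : (gnoFibreBEquiv (L := L)).symm p = ((p.2.1.1 1, p.2.1.1 2), gnoFibreBOf p) := rfl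

/-- The fibre embedding, pointwise. [folklore] -/
theorem gnoFibreBEmb_apply (y : GnoFibreB L) :
    gnoFibreBEmb y = (y (Sum.inl (Sum.inl 0)),
      ((((![y (Sum.inl (Sum.inl 1)), 0, 0] : Fin 3 → ℝ), (![y (Sum.inl (Sum.inl 2)), y (Sum.inl (Sum.inr 0)), y (Sum.inl (Sum.inr 1))] : Fin 3 → ℝ)),
        ((fun k => y (Sum.inr (Sum.inl k))), (fun f k => y (Sum.inr (Sum.inr (f, k)))))) : GnoCoord L)) := rfl

/-- ★ The chart is `base point + fibre direction`: `gnoFibreBEquiv (u, y) = gnoBaseB u + gnoFibreBEmb y`. [folklore] -/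
theorem gnoFibreBEquiv_apply (u : ℝ × ℝ) (y : GnoFibreB L) : gnoFibreBEquiv (u, y) = gnoBaseB u + gnoFibreBEmb y := by
  rw [gnoFibreBEquiv_apply', gnoFibreBEmb_apply, gnoBaseB]
  refine Prod.ext (by simp) (Prod.ext (Prod.ext ?_ ?_) (Prod.ext ?_ ?_))
  · funext k; fin_cases k <;> simp
  · funext k; fin_cases k <;> simp
  · funext k; simp
  · funext f k; simp

/-- The chart along a ray: `gnoFibreBEquiv (u, s • y) = gnoBaseB u + s • gnoFibreBEmb y`. [folklore] -/
theorem gnoFibreBEquiv_apply_smul (u : ℝ × ℝ) (s : ℝ) (y : GnoFibreB L) : gnoFibreBEquiv (u, s • y) = gnoBaseB u + s • gnoFibreBEmb y := by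
  rw [gnoFibreBEquiv_apply, map_smul]

/-- ★ **THE GAUGE IDENTITY**: `‖y‖² = |t|² + |v|² + |z|² + Σ_f |η_f|²` with `((t,v),z,η_F) = gnoFibreBBlocks y`. [folklore] -/
theorem norm_sq_gnoFibreB (y : GnoFibreB L) :
    ‖y‖ ^ 2 = normSq3 (gnoFibreBBlocks y).1.1 + ((gnoFibreBBlocks y).1.2 0 ^ 2 + (gnoFibreBBlocks y).1.2 1 ^ 2) +
      normSq3 (gnoFibreBBlocks y).2.1 + ∑ f, normSq3 ((gnoFibreBBlocks y).2.2 f) := by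
  rw [EuclideanSpace.real_norm_sq_eq, Fintype.sum_sum_type, Fintype.sum_sum_type, Fintype.sum_sum_type, Fintype.sum_prod_type, Fin.sum_univ_two,
    Fin.sum_univ_three]
  simp only [gnoFibreBBlocks, normSq3, Fin.sum_univ_three]
  ring

/-- The index set has `5 + 3 + 3|Fol L|` elements. [folklore] -/
theorem card_gnoFibreBIdx : Fintype.card (GnoFibreBIdx L) = 8 + 3 * Fintype.card (Fol L) := by
  simp only [GnoFibreBIdx, Fintype.card_sum, Fintype.card_fin, Fintype.card_prod]; ring

/-- ★ **THE B-FIBRE DIMENSION** as a real number: `dim V_B = 8 + 3|Fol L|` (`= 2α + 1`, ✓`finrank_gnoFibre_eq_card`). [folklore] -/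
theorem finrank_gnoFibreB_real : (Module.finrank ℝ (GnoFibreB L) : ℝ) = 8 + 3 * (Fintype.card (Fol L) : ℝ) := by
  rw [finrank_euclideanSpace, card_gnoFibreBIdx]; push_cast; ring

/-- The B-base point is continuous (indeed affine) in `u`. [folklore] -/
theorem continuous_gnoBaseB : Continuous fun u : ℝ × ℝ => (gnoBaseB u : ℝ × GnoCoord L) := by
  have h : ∀ u : ℝ × ℝ, gnoFibreBCLE (u, (0 : GnoFibreB L)) = (gnoBaseB u : ℝ × GnoCoord L) := fun u => by
    rw [← gnoFibreBEquiv_apply_eq_CLE, gnoFibreBEquiv_apply, map_zero, add_zero]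
  exact ((gnoFibreBCLE (L := L)).continuous.comp (continuous_id.prodMk continuous_const)).congr h

/-- The chart is measurable. [folklore] -/
theorem measurable_gnoFibreBEquiv : Measurable (gnoFibreBEquiv (L := L)) := (gnoFibreBEquiv (L := L)).measurable

/-- ★ **THE CYLINDER over a base set**: `gnoFibreBEquiv(S × V_B) = {(δ, η) | (η_x 1, η_x 2) ∈ S}`. [folklore] -/
theorem gnoFibreBEquiv_image_prod_univ (S : Set (ℝ × ℝ)) :
    gnoFibreBEquiv '' (S ×ˢ (univ : Set (GnoFibreB L))) = {p : ℝ × GnoCoord L | (p.2.1.1 1, p.2.1.1 2) ∈ S} := by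
  ext p
  constructor
  · rintro ⟨⟨u, y⟩, ⟨hu, -⟩, rfl⟩
    exact hu
  · intro hp
    refine ⟨(gnoFibreBEquiv (L := L)).symm p, ⟨?_, mem_univ _⟩, (gnoFibreBEquiv (L := L)).apply_symm_apply p⟩
    rw [gnoFibreBEquiv_symm_apply]; exact hp

/-- ★ **IN THE CYLINDER BUT OFF THE TUBE ⟹ a fibre vector of norm `> R`**. [folklore] -/
theorem exists_of_mem_cylinderB_not_mem_tube {S : Set (ℝ × ℝ)} {R : ℝ} {p : ℝ × GnoCoord L}
    (hC : p ∈ gnoFibreBEquiv '' (S ×ˢ (univ : Set (GnoFibreB L)))) (hT : p ∉ gnoFibreBEquiv '' (S ×ˢ Metric.closedBall (0 : GnoFibreB L) R)) :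
    ∃ u : ℝ × ℝ, u ∈ S ∧ ∃ y : GnoFibreB L, R < ‖y‖ ∧ p = gnoBaseB u + gnoFibreBEmb y := by
  obtain ⟨⟨u, y⟩, ⟨hu, -⟩, rfl⟩ := hC
  refine ⟨u, hu, y, ?_, gnoFibreBEquiv_apply u y⟩
  by_contra hle
  exact hT ⟨(u, y), ⟨hu, mem_closedBall_zero_iff.2 (not_lt.1 hle)⟩, rfl⟩

/-- The cylinder over a measurable base set is measurable. [folklore] -/
theorem measurableSet_cylinderB {S : Set (ℝ × ℝ)} (hS : MeasurableSet S) : MeasurableSet (gnoFibreBEquiv '' (S ×ˢ (univ : Set (GnoFibreB L)))) :=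
  (gnoFibreBEquiv (L := L)).measurableEmbedding.measurableSet_image.2 (hS.prod MeasurableSet.univ)

/-! ## §3 Volume preservation and the global chart identity -/

/-- The B-fibre read as the letter blocks, as a measurable equivalence. [folklore] -/
def gnoFibreBBlocksEquiv : GnoFibreB L ≃ᵐ ((Fin 3 → ℝ) × (Fin 2 → ℝ)) × (Fin 3 → ℝ) × (Fol L → Fin 3 → ℝ) :=
  ((MeasurableEquiv.toLp 2 (GnoFibreBIdx L → ℝ)).symm.trans (MeasurableEquiv.sumPiEquivProdPi fun _ : GnoFibreBIdx L => ℝ)).trans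
    (MeasurableEquiv.prodCongr (MeasurableEquiv.sumPiEquivProdPi fun _ : Fin 3 ⊕ Fin 2 => ℝ)
      ((MeasurableEquiv.sumPiEquivProdPi fun _ : Fin 3 ⊕ Fol L × Fin 3 => ℝ).trans
        (MeasurableEquiv.prodCongr (MeasurableEquiv.refl (Fin 3 → ℝ)) (MeasurableEquiv.curry (Fol L) (Fin 3) ℝ))))

/-- The block reading preserves volume. [folklore] -/
theorem volume_preserving_gnoFibreBBlocksEquiv : MeasurePreserving (gnoFibreBBlocksEquiv (L := L)) volume volume := by
  refine ((PiLp.volume_preserving_ofLp (GnoFibreBIdx L)).trans (volume_measurePreserving_sumPiEquivProdPi fun _ : GnoFibreBIdx L => ℝ)).trans ?_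
  refine MeasurePreserving.prod (volume_measurePreserving_sumPiEquivProdPi fun _ : Fin 3 ⊕ Fin 2 => ℝ) ?_
  refine (volume_measurePreserving_sumPiEquivProdPi fun _ : Fin 3 ⊕ Fol L × Fin 3 => ℝ).trans ?_
  exact MeasurePreserving.prod (MeasurePreserving.id volume) (QuantitativeLaplace.volume_preserving_curry (ι := Fol L) (κ := Fin 3) (X := ℝ))

omit [NeZero L] in
/-- The block reading IS `gnoFibreBBlocks`, pointwise (by `rfl`). [folklore] -/
theorem gnoFibreBBlocksEquiv_apply (y : GnoFibreB L) : gnoFibreBBlocksEquiv y = gnoFibreBBlocks y := rfl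

/-- Splitting `t ↦ (t 0, (t 1, t 2))` preserves volume (✓`volume_preserving_piFinSuccAbove`, ✓`volume_preserving_finTwoArrow`). [folklore] -/
theorem volume_preserving_splitT :
    MeasurePreserving (fun t : Fin 3 → ℝ => (t 0, (t 1, t 2))) volume volume := by
  have h1 : MeasurePreserving (MeasurableEquiv.piFinSuccAbove (fun _ : Fin 3 => ℝ) 0) volume volume := volume_preserving_piFinSuccAbove (fun _ : Fin 3 => ℝ) 0
  have h2 : MeasurePreserving (Prod.map (id : ℝ → ℝ) (MeasurableEquiv.finTwoArrow : (Fin 2 → ℝ) → ℝ × ℝ)) (volume : Measure (ℝ × (Fin 2 → ℝ))) volume :=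
    (MeasurePreserving.id volume).prod (volume_preserving_finTwoArrow ℝ)
  have e : (fun t : Fin 3 → ℝ => (t 0, (t 1, t 2))) = Prod.map (id : ℝ → ℝ) (MeasurableEquiv.finTwoArrow : (Fin 2 → ℝ) → ℝ × ℝ) ∘
      (MeasurableEquiv.piFinSuccAbove (fun _ : Fin 3 => ℝ) 0) := by
    funext t; rfl
  rw [e]; exact h2.comp h1

/-- The shuffle `(u, ((δ, (x₀, y₀)), v)) ↦ (δ, ((x₀, u), (y₀, v)))` preserves the product volume. [folklore] -/
theorem volume_preserving_shuffleB :
    MeasurePreserving (fun q : (ℝ × ℝ) × ((ℝ × (ℝ × ℝ)) × (Fin 2 → ℝ)) => (q.2.1.1, ((q.2.1.2.1, q.1), (q.2.1.2.2, q.2.2))))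
      (volume : Measure ((ℝ × ℝ) × ((ℝ × (ℝ × ℝ)) × (Fin 2 → ℝ)))) (volume : Measure (ℝ × ((ℝ × (ℝ × ℝ)) × (ℝ × (Fin 2 → ℝ))))) := by
  -- `(u, ((δ,(x₀,y₀)), v))` ↦ `(((δ,(x₀,y₀)), v), u)` ↦ `((δ,(x₀,y₀)), (v, u))` ↦ `(δ, ((x₀,y₀), (v,u)))` ↦ `(δ, ((x₀,(y₀,(v,u)))))` ↦ …
  have h1 : MeasurePreserving (Prod.swap : (ℝ × ℝ) × ((ℝ × (ℝ × ℝ)) × (Fin 2 → ℝ)) → ((ℝ × (ℝ × ℝ)) × (Fin 2 → ℝ)) × (ℝ × ℝ)) volume volume :=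
    Measure.measurePreserving_swap
  have h2 : MeasurePreserving (MeasurableEquiv.prodAssoc : ((ℝ × (ℝ × ℝ)) × (Fin 2 → ℝ)) × (ℝ × ℝ) ≃ᵐ (ℝ × (ℝ × ℝ)) × ((Fin 2 → ℝ) × (ℝ × ℝ))) volume volume :=
    volume_preserving_prodAssoc
  have h3 : MeasurePreserving (MeasurableEquiv.prodAssoc : (ℝ × (ℝ × ℝ)) × ((Fin 2 → ℝ) × (ℝ × ℝ)) ≃ᵐ ℝ × ((ℝ × ℝ) × ((Fin 2 → ℝ) × (ℝ × ℝ)))) volume volume :=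
    volume_preserving_prodAssoc
  have h4 : MeasurePreserving (Prod.map (id : ℝ → ℝ) (MeasurableEquiv.prodAssoc : (ℝ × ℝ) × ((Fin 2 → ℝ) × (ℝ × ℝ)) ≃ᵐ ℝ × (ℝ × ((Fin 2 → ℝ) × (ℝ × ℝ)))))
      (volume : Measure (ℝ × ((ℝ × ℝ) × ((Fin 2 → ℝ) × (ℝ × ℝ))))) (volume : Measure (ℝ × (ℝ × (ℝ × ((Fin 2 → ℝ) × (ℝ × ℝ)))))) :=
    (MeasurePreserving.id volume).prod volume_preserving_prodAssoc
  -- now `(δ, (x₀, (y₀, (v, u))))` ↦ `(δ, (x₀, (u, (y₀, v))))`: on the factor `(y₀, (v, u))` ↦ `(u, (y₀, v))`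
  have h5a : MeasurePreserving (fun r : ℝ × ((Fin 2 → ℝ) × (ℝ × ℝ)) => (r.2.2, (r.1, r.2.1)))
      (volume : Measure (ℝ × ((Fin 2 → ℝ) × (ℝ × ℝ)))) (volume : Measure ((ℝ × ℝ) × (ℝ × (Fin 2 → ℝ)))) := by
    have a1 : MeasurePreserving (MeasurableEquiv.prodAssoc : (ℝ × (Fin 2 → ℝ)) × (ℝ × ℝ) ≃ᵐ ℝ × ((Fin 2 → ℝ) × (ℝ × ℝ))).symm
        (volume : Measure (ℝ × ((Fin 2 → ℝ) × (ℝ × ℝ)))) volume := volume_preserving_prodAssoc.symm _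
    have a2 : MeasurePreserving (Prod.swap : (ℝ × (Fin 2 → ℝ)) × (ℝ × ℝ) → (ℝ × ℝ) × (ℝ × (Fin 2 → ℝ))) volume volume := Measure.measurePreserving_swap
    have e : (fun r : ℝ × ((Fin 2 → ℝ) × (ℝ × ℝ)) => (r.2.2, (r.1, r.2.1))) =
        (Prod.swap : (ℝ × (Fin 2 → ℝ)) × (ℝ × ℝ) → (ℝ × ℝ) × (ℝ × (Fin 2 → ℝ))) ∘
          ((MeasurableEquiv.prodAssoc : (ℝ × (Fin 2 → ℝ)) × (ℝ × ℝ) ≃ᵐ ℝ × ((Fin 2 → ℝ) × (ℝ × ℝ))).symm) := by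
      funext r; rfl
    rw [e]; exact a2.comp a1
  have h5 : MeasurePreserving (Prod.map (id : ℝ → ℝ) (Prod.map (id : ℝ → ℝ) (fun r : ℝ × ((Fin 2 → ℝ) × (ℝ × ℝ)) => (r.2.2, (r.1, r.2.1)))))
      (volume : Measure (ℝ × (ℝ × (ℝ × ((Fin 2 → ℝ) × (ℝ × ℝ)))))) (volume : Measure (ℝ × (ℝ × ((ℝ × ℝ) × (ℝ × (Fin 2 → ℝ)))))) :=
    (MeasurePreserving.id volume).prod ((MeasurePreserving.id volume).prod h5a)
  -- `(δ, (x₀, (u, (y₀, v))))` ↦ `(δ, ((x₀, u), (y₀, v)))`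
  have h6 : MeasurePreserving (Prod.map (id : ℝ → ℝ) (MeasurableEquiv.prodAssoc : (ℝ × (ℝ × ℝ)) × (ℝ × (Fin 2 → ℝ)) ≃ᵐ ℝ × ((ℝ × ℝ) × (ℝ × (Fin 2 → ℝ)))).symm)
      (volume : Measure (ℝ × (ℝ × ((ℝ × ℝ) × (ℝ × (Fin 2 → ℝ)))))) (volume : Measure (ℝ × ((ℝ × (ℝ × ℝ)) × (ℝ × (Fin 2 → ℝ))))) :=
    (MeasurePreserving.id volume).prod (volume_preserving_prodAssoc.symm _)
  have e : (fun q : (ℝ × ℝ) × ((ℝ × (ℝ × ℝ)) × (Fin 2 → ℝ)) => (q.2.1.1, ((q.2.1.2.1, q.1), (q.2.1.2.2, q.2.2)))) =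
      (Prod.map (id : ℝ → ℝ) (MeasurableEquiv.prodAssoc : (ℝ × (ℝ × ℝ)) × (ℝ × (Fin 2 → ℝ)) ≃ᵐ ℝ × ((ℝ × ℝ) × (ℝ × (Fin 2 → ℝ)))).symm) ∘
      (Prod.map (id : ℝ → ℝ) (Prod.map (id : ℝ → ℝ) (fun r : ℝ × ((Fin 2 → ℝ) × (ℝ × ℝ)) => (r.2.2, (r.1, r.2.1))))) ∘
      (Prod.map (id : ℝ → ℝ) (MeasurableEquiv.prodAssoc : (ℝ × ℝ) × ((Fin 2 → ℝ) × (ℝ × ℝ)) ≃ᵐ ℝ × (ℝ × ((Fin 2 → ℝ) × (ℝ × ℝ))))) ∘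
      (MeasurableEquiv.prodAssoc : (ℝ × (ℝ × ℝ)) × ((Fin 2 → ℝ) × (ℝ × ℝ)) ≃ᵐ ℝ × ((ℝ × ℝ) × ((Fin 2 → ℝ) × (ℝ × ℝ)))) ∘
      (MeasurableEquiv.prodAssoc : ((ℝ × (ℝ × ℝ)) × (Fin 2 → ℝ)) × (ℝ × ℝ) ≃ᵐ (ℝ × (ℝ × ℝ)) × ((Fin 2 → ℝ) × (ℝ × ℝ))) ∘
      (Prod.swap : (ℝ × ℝ) × ((ℝ × (ℝ × ℝ)) × (Fin 2 → ℝ)) → ((ℝ × (ℝ × ℝ)) × (Fin 2 → ℝ)) × (ℝ × ℝ)) := by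
    funext q; rfl
  rw [e]
  exact h6.comp (h5.comp (h4.comp (h3.comp (h2.comp h1))))

/-- Inserting the axial coordinates: `((x₀, u), (y₀, v)) ↦ (x₀ ∷ u, y₀ ∷ v)` preserves volume. [folklore] -/
theorem volume_preserving_insertB :
    MeasurePreserving (fun q : (ℝ × (ℝ × ℝ)) × (ℝ × (Fin 2 → ℝ)) =>
      (((MeasurableEquiv.piFinSuccAbove (fun _ : Fin 3 => ℝ) 0).symm (q.1.1, MeasurableEquiv.finTwoArrow.symm q.1.2),
        (MeasurableEquiv.piFinSuccAbove (fun _ : Fin 3 => ℝ) 0).symm q.2) : (Fin 3 → ℝ) × (Fin 3 → ℝ)))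
      volume volume := by
  have hp : MeasurePreserving (MeasurableEquiv.piFinSuccAbove (fun _ : Fin 3 => ℝ) 0).symm volume volume := (volume_preserving_piFinSuccAbove (fun _ : Fin 3 => ℝ) 0).symm _
  have hf : MeasurePreserving (MeasurableEquiv.finTwoArrow : (Fin 2 → ℝ) ≃ᵐ ℝ × ℝ).symm volume volume := (volume_preserving_finTwoArrow ℝ).symm _
  have hx : MeasurePreserving (fun r : ℝ × (ℝ × ℝ) => (MeasurableEquiv.piFinSuccAbove (fun _ : Fin 3 => ℝ) 0).symm (r.1, MeasurableEquiv.finTwoArrow.symm r.2))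
      (volume : Measure (ℝ × (ℝ × ℝ))) volume := by
    have e : (fun r : ℝ × (ℝ × ℝ) => (MeasurableEquiv.piFinSuccAbove (fun _ : Fin 3 => ℝ) 0).symm (r.1, MeasurableEquiv.finTwoArrow.symm r.2)) =
        (MeasurableEquiv.piFinSuccAbove (fun _ : Fin 3 => ℝ) 0).symm ∘ Prod.map (id : ℝ → ℝ) (MeasurableEquiv.finTwoArrow : (Fin 2 → ℝ) ≃ᵐ ℝ × ℝ).symm := by
      funext r; rfl
    rw [e]; exact hp.comp ((MeasurePreserving.id volume).prod hf)
  have hy : MeasurePreserving (fun r : ℝ × (Fin 2 → ℝ) => (MeasurableEquiv.piFinSuccAbove (fun _ : Fin 3 => ℝ) 0).symm r) (volume : Measure (ℝ × (Fin 2 → ℝ))) volume := hp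
  exact hx.prod hy

omit [NeZero L] in
/-- `insertNth 0 a ![b, c] = ![a, b, c]`. [folklore] -/
theorem insertNth_zero_pair (a b c : ℝ) : (Fin.insertNth (α := fun _ : Fin 3 => ℝ) 0 a (![b, c] : Fin 2 → ℝ)) = ![a, b, c] := by
  rw [Fin.insertNth_zero']
  funext k; fin_cases k <;> rfl

/-- ★★ **THE B-CHART PRESERVES VOLUME**: `(gnoFibreBEquiv)_*(vol_{ℝ×ℝ} ⊗ vol_{V_B}) = vol_{ℝ × GnoCoord L}`. [folklore] -/
theorem volume_preserving_gnoFibreBEquiv : MeasurePreserving (gnoFibreBEquiv (L := L)) volume volume := by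
  -- the chart as: blocks, split `t`, shuffle, insert, regroup
  set Φ₁ : (ℝ × ℝ) × GnoFibreB L → (ℝ × ℝ) × (((Fin 3 → ℝ) × (Fin 2 → ℝ)) × ((Fin 3 → ℝ) × (Fol L → Fin 3 → ℝ))) :=
    Prod.map id (gnoFibreBBlocksEquiv (L := L)) with hΦ₁
  have m1 : MeasurePreserving Φ₁ volume volume := (MeasurePreserving.id volume).prod volume_preserving_gnoFibreBBlocksEquiv
  set Φ₂ : (ℝ × ℝ) × (((Fin 3 → ℝ) × (Fin 2 → ℝ)) × ((Fin 3 → ℝ) × (Fol L → Fin 3 → ℝ))) →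
      ((ℝ × ℝ) × (((Fin 3 → ℝ) × (Fin 2 → ℝ)))) × ((Fin 3 → ℝ) × (Fol L → Fin 3 → ℝ)) := fun q => ((q.1, q.2.1), q.2.2) with hΦ₂
  have m2 : MeasurePreserving Φ₂ volume volume :=
    (volume_preserving_prodAssoc (α₁ := ℝ × ℝ) (β₁ := (Fin 3 → ℝ) × (Fin 2 → ℝ)) (γ₁ := (Fin 3 → ℝ) × (Fol L → Fin 3 → ℝ))).symm _
  set Φ₃ : ((ℝ × ℝ) × ((Fin 3 → ℝ) × (Fin 2 → ℝ))) → (ℝ × ℝ) × ((ℝ × (ℝ × ℝ)) × (Fin 2 → ℝ)) :=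
    Prod.map id (Prod.map (fun t : Fin 3 → ℝ => (t 0, (t 1, t 2))) id) with hΦ₃
  have m3 : MeasurePreserving Φ₃ volume volume := (MeasurePreserving.id volume).prod (volume_preserving_splitT.prod (MeasurePreserving.id volume))
  set Φ₄ : (ℝ × ℝ) × ((ℝ × (ℝ × ℝ)) × (Fin 2 → ℝ)) → ℝ × ((ℝ × (ℝ × ℝ)) × (ℝ × (Fin 2 → ℝ))) :=
    fun q => (q.2.1.1, ((q.2.1.2.1, q.1), (q.2.1.2.2, q.2.2))) with hΦ₄
  have m4 : MeasurePreserving Φ₄ volume volume := volume_preserving_shuffleB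
  set Φ₅ : ℝ × ((ℝ × (ℝ × ℝ)) × (ℝ × (Fin 2 → ℝ))) → ℝ × ((Fin 3 → ℝ) × (Fin 3 → ℝ)) :=
    Prod.map id (fun q : (ℝ × (ℝ × ℝ)) × (ℝ × (Fin 2 → ℝ)) =>
      (((MeasurableEquiv.piFinSuccAbove (fun _ : Fin 3 => ℝ) 0).symm (q.1.1, MeasurableEquiv.finTwoArrow.symm q.1.2),
        (MeasurableEquiv.piFinSuccAbove (fun _ : Fin 3 => ℝ) 0).symm q.2) : (Fin 3 → ℝ) × (Fin 3 → ℝ))) with hΦ₅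
  have m5 : MeasurePreserving Φ₅ volume volume := (MeasurePreserving.id volume).prod volume_preserving_insertB
  -- first factor chain `(u, (t, v)) ↦ (δ, (x, y))`, then reattach the rest
  have m345 : MeasurePreserving (Φ₅ ∘ Φ₄ ∘ Φ₃) volume volume := m5.comp (m4.comp m3)
  set Φ₆ : (ℝ × ((Fin 3 → ℝ) × (Fin 3 → ℝ))) × ((Fin 3 → ℝ) × (Fol L → Fin 3 → ℝ)) → ℝ × GnoCoord L := fun q => (q.1.1, (q.1.2, q.2)) with hΦ₆
  have m6 : MeasurePreserving Φ₆ volume volume :=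
    volume_preserving_prodAssoc (α₁ := ℝ) (β₁ := (Fin 3 → ℝ) × (Fin 3 → ℝ)) (γ₁ := (Fin 3 → ℝ) × (Fol L → Fin 3 → ℝ))
  have mtot : MeasurePreserving (Φ₆ ∘ Prod.map (Φ₅ ∘ Φ₄ ∘ Φ₃) id ∘ Φ₂ ∘ Φ₁) volume volume :=
    m6.comp ((m345.prod (MeasurePreserving.id volume)).comp (m2.comp m1))
  have hfun : (gnoFibreBEquiv (L := L) : (ℝ × ℝ) × GnoFibreB L → ℝ × GnoCoord L) = Φ₆ ∘ Prod.map (Φ₅ ∘ Φ₄ ∘ Φ₃) id ∘ Φ₂ ∘ Φ₁ := by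
    funext q
    obtain ⟨⟨u₁, u₂⟩, y⟩ := q
    rw [gnoFibreBEquiv_apply']
    simp only [hΦ₁, hΦ₂, hΦ₃, hΦ₄, hΦ₅, hΦ₆, Function.comp_apply, Prod.map_apply, id_eq, gnoFibreBBlocksEquiv_apply, gnoFibreBBlocks,
      MeasurableEquiv.piFinSuccAbove_symm_apply, MeasurableEquiv.finTwoArrow_symm_apply]
    refine Prod.ext rfl (Prod.ext (Prod.ext ?_ ?_) rfl)
    · change _ = Fin.insertNth (α := fun _ : Fin 3 => ℝ) 0 (y (Sum.inl (Sum.inl 1))) ![u₁, u₂]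
      rw [insertNth_zero_pair]
    · change _ = Fin.insertNth (α := fun _ : Fin 3 => ℝ) 0 (y (Sum.inl (Sum.inl 2))) (fun j => y (Sum.inl (Sum.inr j)))
      rw [insertNth_zero_fin_two]
  rw [hfun]
  exact mtot

/-- ★ **THE GLOBAL B-CHART IDENTITY** for a density `ρ` on `ℝ × GnoCoord L` (e.g. `ρ(δ,η) = ((1+δ²)⁻¹)²·gnoDensity η`):
`vol·ρ = (gnoFibreBEquiv)_*((vol_{ℝ×ℝ} ⊗ vol_{V_B})·(ρ ∘ gnoFibreBEquiv))`. [folklore] -/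
theorem volume_withDensity_eq_map_gnoFibreBEquiv {ρ : ℝ × GnoCoord L → ℝ≥0∞} (hρ : Measurable ρ) :
    (volume : Measure (ℝ × GnoCoord L)).withDensity ρ =
      (((volume : Measure (ℝ × ℝ)).prod (volume : Measure (GnoFibreB L))).withDensity (ρ ∘ gnoFibreBEquiv)).map (gnoFibreBEquiv (L := L)) := by
  have hv : (volume : Measure (ℝ × GnoCoord L)) = ((volume : Measure (ℝ × ℝ)).prod (volume : Measure (GnoFibreB L))).map (gnoFibreBEquiv (L := L)) :=
    (volume_preserving_gnoFibreBEquiv (L := L)).map_eq.symm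
  rw [hv, Literature.Analysis.Asymptotics.withDensity_map_eq_map_withDensity_comp (gnoFibreBEquiv (L := L)).measurable hρ]

end Summit.QuantumFields.YangMills.Theorems.SwapVirialDeficit.BlowUpRing

end
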